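import Literature.GroupTheory.SpecificGroups.PGL2SylowCharP
import HarnessLib

/-!
# Finite subgroups of `PGL₂(k)` in characteristic `p`, II: the Borel normal form

Topic `GroupTheory/SpecificGroups`; theorems plus small definitions (`Gamma`, `Lambda`,
`stabField`, `antidiag`), no named facts.  Second part of Dickson's classification of the finite
`p`-irregular subgroups of `PGL₂(k)` following X. Faber, *Finite `p`-irregular subgroups of
`PGL₂(k)*`, arXiv:1112.1999 = La Matematica 2 (2023) [Faber2011], §3 (Lemmas 3.1–3.2, the
trace criteria), §4.2 (Prop. 4.4–4.5: conjugacy of `p`-groups, the stabiliser field `𝔽_Γ`),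
§4.3 (Props. 4.6–4.7: elements stabilising a pair of points) and §4.4 (Prop. 4.8: the Borel
normal form `(1 Γ; 0 1) ⋊ (μ_n 0; 0 1)` with `μ_n ⊂ 𝔽_Γ^× ⊂ Γ ∖ 0`); after L. E. Dickson,
*Linear groups* (1901), Ch. XII §§241–243 [Dickson1901].  It continues
`Literature/GroupTheory/SpecificGroups/PGL2SylowCharP.lean` (part I) and serves the same
use: the input "classification of finite subgroups of `PGL₂(𝔽̄_q)`" of Newton–Thorne,
*Symmetric power functoriality, II*, Publ. IHES 134 (2021), proof of Prop. 3.7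
[NewtonThorneIHES2021b].

## Contents (all proved)

For a subgroup `H ≤ PGL₂(k)` (notation of part I: `transl β = τ_β`, `homoth a = δ_a`,
`derivInfty`, `stabDeriv`, the Möbius action on `OnePoint k`):

* `conj_transl_eq` (`h τ_β h⁻¹ = τ_{h'(∞) β}` for `h` fixing `∞`), `transl_mul_homoth_pow`,
  `transl_conj_transl_mul_homoth` (**normalisation 1**: `τ_{-z₀} (τ_β δ_a) τ_{z₀} = δ_a` for the
  fixed point `z₀ = β/(1-a)`, Faber §4.4), `orderOf_transl_mul_homoth`.
* `Gamma H : AddSubgroup k` (`β` with `τ_β ∈ H`; Faber's `Γ`, `U_G = (1 Γ; 0 1)`), `card_Gamma`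
  (`|Γ(H)|` = number of translations in `H`), `Lambda H : Subgroup kˣ` (the derivatives at `∞`,
  Faber's `μ_d(k)`), `mul_mem_Gamma` (**`Λ Γ ⊆ Γ`**, Faber Prop. 4.8: "`λΓ ⊂ Γ`").
* `stabField Γ : Subfield k` (**the stabiliser field `𝔽_Γ = {α : αΓ ⊆ Γ}`**, Faber §4.2 /
  Dickson's multiplier), `coe_mem_stabField_of_mem_Lambda` (`Λ ⊆ 𝔽_Γ`),
  `stabField_mul_injective`, `finite_stabField`, `card_stabField_le` (`|𝔽_Γ| ≤ |Γ|`),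
  `exists_eq_mul_of_card_stabField_eq` (`|𝔽_Γ| = |Γ| ⇒ Γ = 𝔽_Γ β₀`), `card_Lambda_le`
  (`|Λ| ≤ |𝔽_Γ| - 1`) — the inequalities `ℓ ≤ m`, `d ≤ p^ℓ - 1` of Faber's Lemma 6.3.
* Transport under conjugation (`MulAut.conj t • H`): `mem_conj_smul_iff`, `Gamma_conj_transl`,
  `mem_Gamma_conj_homoth_iff`, `Lambda_conj_of_smul_infty_eq`, `card_Gamma_conj_homoth`,
  `card_conj_smul`, `exists_forall_homoth_mem_conj_transl` (**normalisation 1 for finite `H`**: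
  after a translation every multiplier is a homothety of the group, i.e. `N = P ⋊ (Λ 0; 0 1)`,
  Faber Prop. 4.8 / §6), `one_mem_Gamma_conj_homoth` (**normalisation 2**: `1 ∈ Γ`, Faber
  Prop. 4.5).
* `mk_pow_char_eq_one_iff_trace_sq` (**trace criterion**: `[g]^p = 1 ↔ tr(g)² = 4 det g`, `k`
  algebraically closed of characteristic `p`, Faber Lemma 3.1), `mk_sq_eq_one_iff_trace_eq_zero`
  (`[g]² = 1 ↔ tr g = 0` for `[g] ≠ 1`, Faber Lemma 3.2, any characteristic).
* Elements fixing or swapping `0, ∞` (Faber §4.3): `exists_eq_homoth_of_smul_infty_of_smul_zero`,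
  `homoth_smul_eq_self_iff`, `antidiag b` (`z ↦ b/z`) with `antidiag_mul_self`,
  `antidiag_mul_homoth_mul_antidiag` (`w δ_a w⁻¹ = δ_{a⁻¹}`),
  `exists_eq_antidiag_of_smul_infty_of_smul_zero`, `smul_infty_mem_of_commute_homoth` (an
  element commuting with `δ_a ≠ 1` stabilises `{0, ∞}`, proof of Prop. 4.7),
  `exists_eq_homoth_of_swap_of_swap` (two swaps differ by a homothety: index `≤ 2`).

## What is NOT here

The counting Lemma 6.3 (`q - 1 ≤ ε_p d`, whence `Γ = 𝔽_q`, `Λ ⊇ (𝔽_qˣ)²`) and §§6.1–6.2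
(identification with `PSL₂(𝔽_q)` / `PGL₂(𝔽_q)`, the dihedral and `𝔄₅` exceptions): parts III–V.

## References

* [Faber2011] X. Faber, *Finite p-irregular subgroups of PGL₂(k)*, arXiv:1112.1999 (2011); La
  Matematica 2 (2023) 479–522 — Lemmas 3.1, 3.2; Props. 4.4, 4.5, 4.6, 4.7, 4.8 (read
  2026-08-15, `lit read arxiv:1112.1999`, chunks p0007–p0010, p0016).
* [Dickson1901] L. E. Dickson, *Linear groups with an exposition of the Galois field theory*,
  Teubner (1901), Ch. XII §§241–243.
* [NewtonThorneIHES2021b] J. Newton, J. A. Thorne, *Symmetric power functoriality for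
  holomorphic modular forms, II*, Publ. Math. IHÉS 134 (2021), proof of Prop. 3.7.
-/

open scoped MatrixGroups OnePoint Pointwise
open Matrix MulAction

namespace Literature.GroupTheory.SpecificGroups.PGL2

open Literature.NumberTheory.GaloisRepresentations

variable {k : Type*} [Field k]

local notation "M₂" => Matrix (Fin 2) (Fin 2) k


section Borel

variable [DecidableEq k]

/-- Conjugating a translation by an element fixing `∞` multiplies it by the derivative:
`h τ_β h⁻¹ = τ_{h'(∞) β}` (Faber 2011, §4.2: `(α β; 0 1)(1 Γ; 0 1)(α β; 0 1)⁻¹ = (1 αΓ; 0 1)`).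
[cite: Faber2011, §4.2] -/
theorem conj_transl_eq {h : PGL(Fin 2, k)} (hh : h • (∞ : OnePoint k) = ∞) (β : k) :
    h * transl β * h⁻¹ = transl (derivInfty h * β) := by
  obtain ⟨γ, a, ha, rfl⟩ := exists_eq_transl_mul_homoth hh
  rw [← ha]
  calc transl γ * homoth a * transl β * (transl γ * homoth a)⁻¹
      = transl γ * (homoth a * transl β * (homoth a)⁻¹) * (transl γ)⁻¹ := by group
    _ = transl γ * transl (a * β) * (transl γ)⁻¹ := by rw [homoth_mul_transl_mul_inv]
    _ = transl (a * β) := by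
        rw [← AddChar.map_neg_eq_inv, ← AddChar.map_add_eq_mul, ← AddChar.map_add_eq_mul]
        congr 1
        ring

omit [DecidableEq k] in
/-- Powers of `τ_β δ_a`: `(τ_β δ_a)^n = τ_{β (1 + a + ⋯ + a^{n-1})} δ_{a^n}`. [folklore] -/
theorem transl_mul_homoth_pow (β : k) (a : kˣ) (n : ℕ) :
    (transl β * homoth a) ^ n =
      transl (β * ∑ i ∈ Finset.range n, (a : k) ^ i) * homoth (a ^ n) := by
  induction n with
  | zero => simp
  | succ n ih =>
    rw [pow_succ, ih, transl_mul_homoth_mul, Finset.sum_range_succ, mul_add, pow_succ]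
    congr 2
    rw [Units.val_pow_eq_pow_val]
    ring

/-- `τ_β δ_a` with `a ≠ 1` fixes the point `β / (1 - a)`. [folklore] -/
theorem transl_mul_homoth_smul_fixedPt (β : k) {a : kˣ} (ha : a ≠ 1) :
    (transl β * homoth a) • ((β / (1 - a) : k) : OnePoint k) = ((β / (1 - a) : k) : OnePoint k) := by
  have h1a : (1 : k) - a ≠ 0 := sub_ne_zero.mpr (fun h => ha (Units.ext h.symm))
  rw [transl_mul_homoth_smul_coe, OnePoint.coe_eq_coe]
  field_simp
  ring

omit [DecidableEq k] in
/-- **Conjugating the complement to fix `0`**: for `a ≠ 1`, translating by the fixed point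
`z₀ = β/(1-a)` turns `τ_β δ_a` into the homothety `δ_a`: `τ_{-z₀} (τ_β δ_a) τ_{z₀} = δ_a`
(Faber 2011, §4.4: "After conjugating `G` by an element of `U(k)`, we may assume that `s` fixes
`0`, so that it is of the form `s = (λ 0; 0 1)`"). [cite: Faber2011, §4.4] -/
theorem transl_conj_transl_mul_homoth (β : k) {a : kˣ} (ha : a ≠ 1) :
    transl (-(β / (1 - a))) * (transl β * homoth a) * transl (β / (1 - a)) = homoth a := by
  have h1a : (1 : k) - a ≠ 0 := sub_ne_zero.mpr (fun h => ha (Units.ext h.symm))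
  simp only [mul_assoc]
  rw [homoth_mul_transl, ← mul_assoc, ← mul_assoc, ← AddChar.map_add_eq_mul,
    ← AddChar.map_add_eq_mul]
  conv_rhs => rw [← one_mul (homoth a), ← AddChar.map_zero_eq_one transl]
  congr 2
  field_simp
  ring

/-- The order of `τ_β δ_a` with `a ≠ 1` is the order of `a` (it is conjugate to `δ_a`).
[folklore] -/
theorem orderOf_transl_mul_homoth (β : k) {a : kˣ} (ha : a ≠ 1) :
    orderOf (transl β * homoth a) = orderOf a := by
  have hconj : MulAut.conj (transl (-(β / (1 - a)))) (transl β * homoth a) = homoth a := by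
    rw [MulAut.conj_apply, ← AddChar.map_neg_eq_inv, neg_neg]
    exact transl_conj_transl_mul_homoth β ha
  conv_rhs => rw [← orderOf_injective homoth homoth_injective a, ← hconj]
  exact (MulEquiv.orderOf_eq _ _).symm

/-! ### The parameters `Γ(H) ≤ (k, +)` and `Λ(H) ≤ kˣ` of a subgroup -/

/-- **The translation part `Γ(H)`** of a subgroup `H ≤ PGL₂(k)`: the additive subgroup of `β ∈ k`
with `τ_β ∈ H` (Faber 2011, §4.2: "`U_G = U(k) ∩ G = (1 Γ; 0 1)` for some additive subgroup
`Γ ⊂ k`"). [cite: Faber2011, §4.2, Lemma 4.3] -/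
def Gamma (H : Subgroup PGL(Fin 2, k)) : AddSubgroup k where
  carrier := {β | transl β ∈ H}
  zero_mem' := by
    change transl (0 : k) ∈ H
    rw [AddChar.map_zero_eq_one]
    exact one_mem H
  add_mem' {a b} ha hb := by
    change transl (a + b) ∈ H
    rw [AddChar.map_add_eq_mul]
    exact mul_mem ha hb
  neg_mem' {a} ha := by
    change transl (-a) ∈ H
    rw [AddChar.map_neg_eq_inv]
    exact inv_mem ha

omit [DecidableEq k] in
/-- Membership in `Γ(H)`. [folklore] -/
theorem mem_Gamma_iff {H : Subgroup PGL(Fin 2, k)} {β : k} : β ∈ Gamma H ↔ transl β ∈ H :=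
  Iff.rfl

/-- `Γ(H) → {translations in H}`, `β ↦ τ_β`, is a bijection. [folklore] -/
theorem gammaToTransl_bijective (H : Subgroup PGL(Fin 2, k)) :
    Function.Bijective (fun β : Gamma H =>
      (⟨⟨transl (β : k), β.2⟩, (mem_translSubgroup_iff H).mpr ⟨β, rfl⟩⟩ : translSubgroup H)) := by
  constructor
  · intro x y hxy
    have := congrArg (fun s : translSubgroup H => ((s : H) : PGL(Fin 2, k))) hxy
    exact Subtype.ext (transl_injective this)
  · intro s
    obtain ⟨β, hβ⟩ := (mem_translSubgroup_iff H).mp s.2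
    have hβH : transl β ∈ H := by rw [← hβ]; exact (s : H).2
    exact ⟨⟨β, hβH⟩, Subtype.ext (Subtype.ext hβ.symm)⟩

/-- `|Γ(H)|` is the number of translations in `H`. [folklore] -/
theorem card_Gamma (H : Subgroup PGL(Fin 2, k)) :
    Nat.card (Gamma H) = Nat.card (translSubgroup H) :=
  Nat.card_eq_of_bijective _ (gammaToTransl_bijective H)

/-- `Γ(H)` is finite for finite `H`. [folklore] -/
instance finite_Gamma (H : Subgroup PGL(Fin 2, k)) [Finite H] : Finite (Gamma H) :=
  Finite.of_injective _ (gammaToTransl_bijective H).1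

/-- **The multiplier part `Λ(H) ≤ kˣ`**: the derivatives at `∞` of the elements of `H` fixing
`∞` (Faber 2011, §4.4 / §6: `N = P ⋊ (μ_d 0; 0 1)`, `Λ = μ_d(k)`). [cite: Faber2011, §4.4, Prop. 4.8] -/
noncomputable def Lambda (H : Subgroup PGL(Fin 2, k)) : Subgroup kˣ := (stabDeriv H).range

/-- Membership in `Λ(H)`. [folklore] -/
theorem mem_Lambda_iff {H : Subgroup PGL(Fin 2, k)} {a : kˣ} :
    a ∈ Lambda H ↔ ∃ h ∈ H, h • (∞ : OnePoint k) = ∞ ∧ derivInfty h = a := by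
  rw [Lambda, MonoidHom.mem_range]
  constructor
  · rintro ⟨s, rfl⟩
    refine ⟨(s : H), (s : H).2, ?_, rfl⟩
    have := s.2
    rwa [mem_stabilizer_iff, Subgroup.smul_def] at this
  · rintro ⟨h, hh, hhi, ha⟩
    exact ⟨⟨⟨h, hh⟩, by rw [mem_stabilizer_iff, Subgroup.smul_def]; exact hhi⟩, Units.ext ha⟩

/-- **`Λ(H) Γ(H) ⊆ Γ(H)`**: the multipliers stabilise the translation part
(Faber 2011, §4.4: "`λΓ ⊂ Γ`. That is, `μ_n(k) ⊂ 𝔽_Γ^×`"). [cite: Faber2011, §4.4, Prop. 4.8] -/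
theorem mul_mem_Gamma {H : Subgroup PGL(Fin 2, k)} {a : kˣ} (ha : a ∈ Lambda H) {β : k}
    (hβ : β ∈ Gamma H) : (a : k) * β ∈ Gamma H := by
  obtain ⟨h, hh, hhi, ha'⟩ := mem_Lambda_iff.mp ha
  rw [mem_Gamma_iff, ← ha', ← conj_transl_eq hhi]
  exact mul_mem (mul_mem hh hβ) (inv_mem hh)

/-! ### The stabiliser field of a finite additive subgroup -/

omit [DecidableEq k] in
/-- Multiplication by a non-zero `α` with `α Γ ⊆ Γ` permutes the finite additive subgroup `Γ`.
[folklore] -/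
theorem exists_mul_eq_of_forall_mul_mem {Γ : AddSubgroup k} [Finite Γ] {α : k} (hα : α ≠ 0)
    (h : ∀ β ∈ Γ, α * β ∈ Γ) {β : k} (hβ : β ∈ Γ) : ∃ β' ∈ Γ, α * β' = β := by
  have hinj : Function.Injective (fun γ : Γ => (⟨α * γ, h γ γ.2⟩ : Γ)) := by
    intro x y hxy
    have := congrArg Subtype.val hxy
    exact Subtype.ext (mul_left_cancel₀ hα this)
  obtain ⟨γ, hγ⟩ := Finite.surjective_of_injective hinj ⟨β, hβ⟩
  exact ⟨γ, γ.2, congrArg Subtype.val hγ⟩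

/-- **The stabiliser field** `𝔽_Γ = {α ∈ k : α Γ ⊆ Γ}` of a finite additive subgroup `Γ ⊆ k`,
a subfield of `k` (Faber 2011, §4.2: "one verifies easily that `𝔽_Γ` is a subfield of `k` …
a finite subfield"; Dickson's *multiplier*). [cite: Faber2011, §4.2] -/
def stabField (Γ : AddSubgroup k) [Finite Γ] : Subfield k where
  carrier := {α | ∀ β ∈ Γ, α * β ∈ Γ}
  mul_mem' {a b} ha hb β hβ := by rw [mul_assoc]; exact ha _ (hb β hβ)
  one_mem' β hβ := by rwa [one_mul]
  add_mem' {a b} ha hb β hβ := by rw [add_mul]; exact add_mem (ha β hβ) (hb β hβ)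
  zero_mem' β _ := by rw [zero_mul]; exact zero_mem Γ
  neg_mem' {a} ha β hβ := by rw [neg_mul]; exact neg_mem (ha β hβ)
  inv_mem' a ha β hβ := by
    by_cases ha0 : a = 0
    · rw [ha0, _root_.inv_zero, zero_mul]; exact zero_mem Γ
    · obtain ⟨β', hβ', rfl⟩ := exists_mul_eq_of_forall_mul_mem ha0 ha hβ
      rwa [inv_mul_cancel_left₀ ha0]

/-- Membership in the stabiliser field. [folklore] -/
theorem mem_stabField_iff {Γ : AddSubgroup k} [Finite Γ] {α : k} :
    α ∈ stabField Γ ↔ ∀ β ∈ Γ, α * β ∈ Γ := Iff.rfl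

/-- `Λ(H) ⊆ 𝔽_{Γ(H)}` (Faber 2011, §4.4: "`μ_n(k) ⊂ 𝔽_Γ^×`"). [cite: Faber2011, Prop. 4.8] -/
theorem coe_mem_stabField_of_mem_Lambda {H : Subgroup PGL(Fin 2, k)} [Finite H] {a : kˣ}
    (ha : a ∈ Lambda H) : (a : k) ∈ stabField (Gamma H) :=
  fun _ hβ => mul_mem_Gamma ha hβ

/-- For `Γ ≠ 0`, `α ↦ α β₀` (`β₀ ∈ Γ ∖ 0`) embeds `𝔽_Γ` into `Γ`; in particular
`|𝔽_Γ| ≤ |Γ|` and `𝔽_Γ` is finite. [cite: Faber2011, §4.2] -/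
theorem stabField_mul_injective {Γ : AddSubgroup k} [Finite Γ] {β₀ : k} (hβ₀ : β₀ ∈ Γ)
    (h0 : β₀ ≠ 0) :
    Function.Injective (fun α : stabField Γ => (⟨(α : k) * β₀, α.2 β₀ hβ₀⟩ : Γ)) := by
  intro x y hxy
  have := congrArg Subtype.val hxy
  exact Subtype.ext (mul_right_cancel₀ h0 this)

/-- `𝔽_Γ` is finite when `Γ ≠ 0`. [cite: Faber2011, §4.2] -/
theorem finite_stabField {Γ : AddSubgroup k} [Finite Γ] (hΓ : Γ ≠ ⊥) : Finite (stabField Γ) := by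
  obtain ⟨⟨β₀, hβ₀⟩, h0⟩ := AddSubgroup.ne_bot_iff_exists_ne_zero.mp hΓ
  have h0' : β₀ ≠ 0 := fun h => h0 (Subtype.ext h)
  exact Finite.of_injective _ (stabField_mul_injective hβ₀ h0')

/-- `|𝔽_Γ| ≤ |Γ|` when `Γ ≠ 0` (so `ℓ ≤ m` for `|𝔽_Γ| = p^ℓ`, `|Γ| = p^m`). [cite: Faber2011, §6] -/
theorem card_stabField_le {Γ : AddSubgroup k} [Finite Γ] (hΓ : Γ ≠ ⊥) :
    Nat.card (stabField Γ) ≤ Nat.card Γ := by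
  obtain ⟨⟨β₀, hβ₀⟩, h0⟩ := AddSubgroup.ne_bot_iff_exists_ne_zero.mp hΓ
  have h0' : β₀ ≠ 0 := fun h => h0 (Subtype.ext h)
  haveI := finite_stabField hΓ
  exact Nat.card_le_card_of_injective _ (stabField_mul_injective hβ₀ h0')

/-- **`Γ = 𝔽_Γ β₀` when `|𝔽_Γ| = |Γ|`**: then `Γ` is the line through any `β₀ ∈ Γ ∖ 0`
(Faber 2011, §6: "`ℓ = m` … Now `Γ = 𝔽_Γ = 𝔽_q`" after the homothety `β₀ ↦ 1`).
[cite: Faber2011, Lemma 6.3] -/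
theorem exists_eq_mul_of_card_stabField_eq {Γ : AddSubgroup k} [Finite Γ] {β₀ : k} (hβ₀ : β₀ ∈ Γ)
    (h0 : β₀ ≠ 0) (hcard : Nat.card (stabField Γ) = Nat.card Γ) {β : k} (hβ : β ∈ Γ) :
    ∃ α ∈ stabField Γ, α * β₀ = β := by
  haveI : Finite (stabField Γ) := Finite.of_injective _ (stabField_mul_injective hβ₀ h0)
  have hbij := (Nat.bijective_iff_injective_and_card _).mpr
    ⟨stabField_mul_injective hβ₀ h0, hcard⟩
  obtain ⟨α, hα⟩ := hbij.2 ⟨β, hβ⟩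
  exact ⟨α, α.2, congrArg Subtype.val hα⟩

/-- `|Λ(H)| ≤ |𝔽_{Γ(H)}| - 1` when `Γ(H) ≠ 0`: `Λ(H)` embeds into the non-zero elements of the
finite stabiliser field (Faber 2011, §6: "`d ≤ p^ℓ - 1` (`p^ℓ = |𝔽_Γ|`)"). [cite: Faber2011, Lemma 6.3] -/
theorem card_Lambda_le {H : Subgroup PGL(Fin 2, k)} [Finite H] (hΓ : Gamma H ≠ ⊥) :
    Nat.card (Lambda H) ≤ Nat.card (stabField (Gamma H)) - 1 := by
  haveI := finite_stabField hΓ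
  -- `Λ(H) ↪ 𝔽_Γ ∖ {0}`
  let f : Lambda H → {α : stabField (Gamma H) // α ≠ 0} := fun a =>
    ⟨⟨(a : kˣ), coe_mem_stabField_of_mem_Lambda a.2⟩, fun h => (a : kˣ).ne_zero
      (congrArg Subtype.val h)⟩
  have hf : Function.Injective f := by
    intro x y hxy
    have := congrArg (fun t => ((t.1 : stabField (Gamma H)) : k)) hxy
    exact Subtype.ext (Units.ext this)
  calc Nat.card (Lambda H) ≤ Nat.card {α : stabField (Gamma H) // α ≠ 0} :=
        Nat.card_le_card_of_injective f hf
    _ = Nat.card (stabField (Gamma H)) - 1 := by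
        have := Nat.card_congr (Equiv.optionSubtypeNe (0 : stabField (Gamma H)))
        rw [Finite.card_option] at this
        omega

/-! ### Conjugating `H`: transport of `Γ`, `Λ` and the normalisations -/

omit [DecidableEq k] in
/-- Membership in a conjugate subgroup: `x ∈ t H t⁻¹` iff `t⁻¹ x t ∈ H`. [folklore] -/
theorem mem_conj_smul_iff {H : Subgroup PGL(Fin 2, k)} {t x : PGL(Fin 2, k)} :
    x ∈ MulAut.conj t • H ↔ t⁻¹ * x * t ∈ H := by
  rw [Subgroup.mem_pointwise_smul_iff_inv_smul_mem, ← map_inv, MulAut.smul_def, MulAut.conj_apply,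
    inv_inv]

/-- A conjugate of a finite subgroup is finite. [folklore] -/
instance finite_conj_smul (H : Subgroup PGL(Fin 2, k)) [Finite H] (t : PGL(Fin 2, k)) :
    Finite (MulAut.conj t • H : Subgroup PGL(Fin 2, k)) :=
  Finite.of_equiv H (Subgroup.equivSMul (MulAut.conj t) H).toEquiv

omit [DecidableEq k] in
/-- **Translations do not change `Γ`**: `Γ(τ_c H τ_c⁻¹) = Γ(H)`. [folklore] -/
theorem Gamma_conj_transl (H : Subgroup PGL(Fin 2, k)) (c : k) :
    Gamma (MulAut.conj (transl c) • H) = Gamma H := by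
  ext β
  rw [mem_Gamma_iff, mem_Gamma_iff, mem_conj_smul_iff, ← AddChar.map_neg_eq_inv,
    ← AddChar.map_add_eq_mul, ← AddChar.map_add_eq_mul]
  congr! 2
  ring

omit [DecidableEq k] in
/-- **Homotheties rescale `Γ`**: `β ∈ Γ(δ_a H δ_a⁻¹)` iff `a⁻¹ β ∈ Γ(H)`. [folklore] -/
theorem mem_Gamma_conj_homoth_iff (H : Subgroup PGL(Fin 2, k)) (a : kˣ) (β : k) :
    β ∈ Gamma (MulAut.conj (homoth a) • H) ↔ ((a⁻¹ : kˣ) : k) * β ∈ Gamma H := by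
  rw [mem_Gamma_iff, mem_Gamma_iff, mem_conj_smul_iff, ← map_inv,
    ← homoth_mul_transl_mul_inv a⁻¹ β, map_inv, inv_inv]

/-- The derivative at `∞` is invariant under conjugation by elements fixing `∞`. [folklore] -/
theorem derivInfty_conj {t h : PGL(Fin 2, k)} (ht : t • (∞ : OnePoint k) = ∞)
    (hh : h • (∞ : OnePoint k) = ∞) : derivInfty (t⁻¹ * h * t) = derivInfty h := by
  have hti : t⁻¹ • (∞ : OnePoint k) = ∞ := by rw [inv_smul_eq_iff, ht]
  rw [derivInfty_mul (by rw [mul_smul, hh, hti]) ht, derivInfty_mul hti hh]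
  have h1 : derivInfty t⁻¹ * derivInfty t = 1 := by
    rw [← derivInfty_mul hti ht, inv_mul_cancel, ← map_one homoth, derivInfty_homoth, Units.val_one]
  calc derivInfty t⁻¹ * derivInfty h * derivInfty t
      = derivInfty h * (derivInfty t⁻¹ * derivInfty t) := by ring
    _ = derivInfty h := by rw [h1, mul_one]

/-- **`Λ` is unchanged by conjugation by an element fixing `∞`.** [folklore] -/
theorem Lambda_conj_of_smul_infty_eq (H : Subgroup PGL(Fin 2, k)) {t : PGL(Fin 2, k)}
    (ht : t • (∞ : OnePoint k) = ∞) : Lambda (MulAut.conj t • H) = Lambda H := by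
  have hti : t⁻¹ • (∞ : OnePoint k) = ∞ := by rw [inv_smul_eq_iff, ht]
  ext a
  simp only [mem_Lambda_iff, mem_conj_smul_iff]
  constructor
  · rintro ⟨h, hh, hhi, hha⟩
    refine ⟨t⁻¹ * h * t, hh, by rw [mul_smul, mul_smul, ht, hhi, hti], ?_⟩
    rw [derivInfty_conj ht hhi, hha]
  · rintro ⟨h, hh, hhi, hha⟩
    refine ⟨t * h * t⁻¹, by simpa [mul_assoc] using hh, by rw [mul_smul, mul_smul, hti, hhi, ht],
      ?_⟩
    have := derivInfty_conj hti hhi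
    rw [inv_inv] at this
    rw [this, hha]

/-- Conjugation by an element fixing `∞` preserves "the subgroup `Q ≤ H` fixes `∞`", in the form
needed for Sylow subgroups: the image of `Q` in `t H t⁻¹` fixes `∞`. [folklore] -/
theorem smul_infty_eq_of_conj_smul_infty_eq {t : PGL(Fin 2, k)}
    (ht : t • (∞ : OnePoint k) = ∞) {x : PGL(Fin 2, k)} (hx : (t⁻¹ * x * t) • (∞ : OnePoint k) = ∞) :
    x • (∞ : OnePoint k) = ∞ := by
  have hti : t⁻¹ • (∞ : OnePoint k) = ∞ := by rw [inv_smul_eq_iff, ht]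
  rw [mul_smul, mul_smul, ht, inv_smul_eq_iff, ht] at hx
  exact hx

/-- **Normalisation 1 (the complement fixes `0`)**: if `H` is finite then, after conjugating by
a suitable translation `τ_c`, every multiplier is realised by a homothety in the group:
`δ_a ∈ τ_c H τ_c⁻¹` for all `a ∈ Λ(H) = Λ(τ_c H τ_c⁻¹)` (Faber 2011, §4.4 / §6: "After a suitable
conjugation of `G` we may suppose that `N = P ⋊ (μ_d(k) 0; 0 1)`"; here: `Λ(H)` is cyclic,
generated by the derivative of some `h = τ_β δ_a ∈ H`, and `τ_{-z₀} h τ_{z₀} = δ_a` for the fixed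
point `z₀` of `h`). [cite: Faber2011, Prop. 4.8] -/
theorem exists_forall_homoth_mem_conj_transl (H : Subgroup PGL(Fin 2, k)) [Finite H] :
    ∃ c : k, ∀ b ∈ Lambda H,
      homoth b ∈ (MulAut.conj (transl c) • H : Subgroup PGL(Fin 2, k)) := by
  haveI : Finite (Lambda H) := Finite.of_surjective _ (stabDeriv H).rangeRestrict_surjective
  obtain ⟨g, hg⟩ := IsCyclic.exists_generator (α := Lambda H)
  obtain ⟨h, hh, hhi, hha⟩ := mem_Lambda_iff.mp g.2
  obtain ⟨β, a, ha, rfl⟩ := exists_eq_transl_mul_homoth hhi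
  have hag : a = (g : kˣ) := Units.ext (by rw [ha, hha])
  have hpow : ∀ b ∈ Lambda H, ∃ n : ℤ, a ^ n = b := by
    intro b hb
    obtain ⟨n, hn⟩ := Subgroup.mem_zpowers_iff.mp (hg ⟨b, hb⟩)
    refine ⟨n, ?_⟩
    rw [hag]
    have := congrArg Subtype.val hn
    simpa using this
  by_cases ha1 : a = 1
  · refine ⟨0, fun b hb => ?_⟩
    obtain ⟨n, rfl⟩ := hpow b hb
    rw [ha1, one_zpow, map_one]
    exact one_mem _
  · refine ⟨-(β / (1 - a)), fun b hb => ?_⟩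
    obtain ⟨n, rfl⟩ := hpow b hb
    rw [map_zpow]
    refine zpow_mem ?_ n
    have hconj : homoth a = MulAut.conj (transl (-(β / (1 - a)))) • (transl β * homoth a) := by
      rw [MulAut.smul_def, MulAut.conj_apply, ← AddChar.map_neg_eq_inv, neg_neg,
        transl_conj_transl_mul_homoth β ha1]
    rw [hconj]
    exact Subgroup.smul_mem_pointwise_smul _ _ _ hh

omit [DecidableEq k] in
/-- Homotheties commute, so conjugating by a homothety does not move homotheties. [folklore] -/
theorem homoth_mem_conj_homoth_iff (H : Subgroup PGL(Fin 2, k)) (a b : kˣ) :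
    homoth a ∈ (MulAut.conj (homoth b) • H : Subgroup PGL(Fin 2, k)) ↔ homoth a ∈ H := by
  rw [mem_conj_smul_iff, ← map_inv, ← map_mul, ← map_mul, mul_comm b⁻¹ a, inv_mul_cancel_right]

omit [DecidableEq k] in
/-- Conjugating by a translation does not move translations. [folklore] -/
theorem transl_mem_conj_transl_iff (H : Subgroup PGL(Fin 2, k)) (β c : k) :
    transl β ∈ (MulAut.conj (transl c) • H : Subgroup PGL(Fin 2, k)) ↔ transl β ∈ H := by
  rw [← mem_Gamma_iff, ← mem_Gamma_iff, Gamma_conj_transl]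

omit [DecidableEq k] in
/-- **Normalisation 2 (`1 ∈ Γ`)**: conjugating by the homothety `δ_{β₀⁻¹}` for some
`β₀ ∈ Γ(H) ∖ 0` puts `1` into `Γ` (Faber 2011, Prop. 4.5: "The group `γ⁻¹Γ` contains the element
`1 ∈ k`; let us replace `Γ` with `γ⁻¹Γ`"). [cite: Faber2011, Prop. 4.5] -/
theorem one_mem_Gamma_conj_homoth {H : Subgroup PGL(Fin 2, k)} {β₀ : k} (hβ₀ : β₀ ∈ Gamma H)
    (h0 : β₀ ≠ 0) : (1 : k) ∈ Gamma (MulAut.conj (homoth (Units.mk0 β₀ h0)⁻¹) • H) := by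
  rw [mem_Gamma_conj_homoth_iff, inv_inv, mul_one]
  exact hβ₀

omit [DecidableEq k] in
/-- Conjugating by a homothety rescales `Γ` bijectively; in particular `|Γ|` is unchanged.
[folklore] -/
theorem card_Gamma_conj_homoth (H : Subgroup PGL(Fin 2, k)) [Finite H] (a : kˣ) :
    Nat.card (Gamma (MulAut.conj (homoth a) • H)) = Nat.card (Gamma H) := by
  refine (Nat.card_eq_of_bijective (fun β : Gamma H =>
    (⟨(a : k) * β, by rw [mem_Gamma_conj_homoth_iff, ← mul_assoc, Units.inv_mul, one_mul]; exact β.2⟩ :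
      Gamma (MulAut.conj (homoth a) • H))) ⟨?_, ?_⟩).symm
  · intro x y hxy
    have := congrArg Subtype.val hxy
    exact Subtype.ext (mul_left_cancel₀ a.ne_zero this)
  · intro β
    refine ⟨⟨((a⁻¹ : kˣ) : k) * β, (mem_Gamma_conj_homoth_iff H a β).mp β.2⟩, Subtype.ext ?_⟩
    change (a : k) * (((a⁻¹ : kˣ) : k) * β) = β
    rw [← mul_assoc, Units.mul_inv, one_mul]

omit [DecidableEq k] in
/-- A conjugate subgroup has the same order. [folklore] -/
theorem card_conj_smul (H : Subgroup PGL(Fin 2, k)) (t : PGL(Fin 2, k)) :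
    Nat.card (MulAut.conj t • H : Subgroup PGL(Fin 2, k)) = Nat.card H :=
  (Nat.card_congr (Subgroup.equivSMul (MulAut.conj t) H).toEquiv).symm

/-! ### The trace criterion for `p`-elements -/

omit [DecidableEq k] in
/-- For a `2 × 2` matrix, `det (1 + N) = 1 + tr N + det N`. [folklore] -/
theorem det_one_add_fin_two (N : M₂) : (1 + N).det = 1 + N.trace + N.det := by
  rw [Matrix.det_fin_two, Matrix.det_fin_two, Matrix.trace_fin_two]
  simp only [Matrix.add_apply, Matrix.one_apply_eq, Matrix.one_apply_ne (by decide : (0 : Fin 2) ≠ 1),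
    Matrix.one_apply_ne (by decide : (1 : Fin 2) ≠ 0)]
  ring

omit [DecidableEq k] in
/-- Trace and determinant scale under `u • g`. [folklore] -/
theorem trace_sq_sub_det_smul (u : k) (A : M₂) :
    (u • A).trace ^ 2 - 4 * (u • A).det = u ^ 2 * (A.trace ^ 2 - 4 * A.det) := by
  rw [Matrix.trace_smul, Matrix.det_smul, Fintype.card_fin, smul_eq_mul]
  ring

section TraceCriterion

variable (p : ℕ) [Fact p.Prime] [CharP k p]

omit [DecidableEq k] in
/-- **The trace criterion for `p`-elements** (`k` algebraically closed of characteristic `p`):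
`[g] ^ p = 1` iff `tr(g)² = 4 det(g)`, i.e. iff the discriminant of `g` vanishes (Faber 2011,
Lemma 3.1: "`s` has order `p` … (iff) `Tr(s)² = 4 det(s)`", here including `[g] = 1`).
[cite: Faber2011, Lemma 3.1] -/
theorem mk_pow_char_eq_one_iff_trace_sq [IsAlgClosed k] (g : GL (Fin 2) k) :
    Matrix.ProjGenLinGroup.mk g ^ p = 1 ↔ (g : M₂).trace ^ 2 = 4 * (g : M₂).det := by
  have pp : p.Prime := Fact.out
  constructor
  · intro hp
    obtain ⟨g', hg', hg'p⟩ := KleinGeometry.exists_lift_pow_eq_one (Matrix.ProjGenLinGroup.mk g) pp.pos hp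
    -- `g' = 1 + N` with `N² = 0`: `tr g' = 2`, `det g' = 1`
    have hNN := sub_one_mul_self_eq_zero_of_pow_char_eq_one p hg'p
    set N : M₂ := (g' : M₂) - 1 with hN
    have htrN : N.trace = 0 := (Matrix.isNilpotent_trace_of_isNilpotent ⟨2, by rw [pow_two, hNN]⟩).eq_zero
    have hdetN : N.det = 0 := by
      have : N.det ^ 2 = 0 := by rw [pow_two, ← det_mul, hNN, det_zero]
      exact pow_eq_zero_iff two_ne_zero |>.mp this
    have hg'1 : (g' : M₂) = 1 + N := by rw [hN]; abel
    have htr' : (g' : M₂).trace = 2 := by rw [hg'1, Matrix.trace_add, Matrix.trace_one, Fintype.card_fin, htrN]; norm_num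
    have hdet' : (g' : M₂).det = 1 := by rw [hg'1, det_one_add_fin_two, htrN, hdetN, add_zero, add_zero]
    -- `g = u • g'`
    obtain ⟨u, hu⟩ := GL2.mk_eq_mk_iff_smul.mp hg'
    have key := trace_sq_sub_det_smul (u : k) (g' : M₂)
    rw [hu, htr', hdet'] at key
    have : (g : M₂).trace ^ 2 - 4 * (g : M₂).det = 0 := by rw [key]; ring
    exact sub_eq_zero.mp this
  · intro h
    -- a double eigenvalue `l`: `2 l = tr`, `l² = det`, `(g - l)² = 0`
    obtain ⟨l, hl⟩ := Serre1972.exists_root_quadratic (g : M₂).trace (g : M₂).det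
    have h2l : 2 * l - (g : M₂).trace = 0 := by
      have : (2 * l - (g : M₂).trace) ^ 2 = 0 := by linear_combination 4 * hl + h
      exact pow_eq_zero_iff two_ne_zero |>.mp this
    have hsum : l + l = (g : M₂).trace := by linear_combination h2l
    have hll : l * l = (g : M₂).det := by linear_combination -hl + l * h2l
    have hl0 : l ≠ 0 := by
      intro hl0
      apply GL2.det_ne_zero g
      rw [← hll, hl0, mul_zero]
    have hNN := GL2.sub_mul_sub_eq_zero (g : M₂) hsum hll
    -- rescale: `g' = l⁻¹ g` has `(g' - 1)² = 0`
    set g' : GL (Fin 2) k := g * Matrix.GeneralLinearGroup.scalar (Fin 2) (Units.mk0 l hl0)⁻¹ with hg'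
    have hmk : Matrix.ProjGenLinGroup.mk g' = Matrix.ProjGenLinGroup.mk g := by
      rw [hg', map_mul, Matrix.ProjGenLinGroup.mk_scalar, mul_one]
    have hval : (g' : M₂) = l⁻¹ • (g : M₂) := by
      rw [hg', GL2.coe_mul_scalar, Units.val_inv_eq_inv_val, Units.val_mk0]
    have hsub : (g' : M₂) - 1 = l⁻¹ • ((g : M₂) - l • (1 : M₂)) := by
      rw [hval, smul_sub, smul_smul, inv_mul_cancel₀ hl0, one_smul]
    have hNN' : ((g' : M₂) - 1) * ((g' : M₂) - 1) = 0 := by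
      rw [hsub, Matrix.smul_mul, Matrix.mul_smul, hNN, smul_zero, smul_zero]
    rw [← hmk, ← map_pow, pow_char_eq_one_of_sub_one_mul_self_eq_zero p hNN', map_one]

end TraceCriterion

omit [DecidableEq k] in
/-- **The trace criterion for involutions**: for `[g] ≠ 1`, `[g]² = 1` iff `tr g = 0` (Faber 2011,
Lemma 3.2: "`s` has order `2` if and only if `Tr(s) = 0`"; by Cayley–Hamilton
`g² = tr(g) g - det(g)`, valid in every characteristic). [cite: Faber2011, Lemma 3.2] -/
theorem mk_sq_eq_one_iff_trace_eq_zero {g : GL (Fin 2) k} (hg : Matrix.ProjGenLinGroup.mk g ≠ 1) :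
    Matrix.ProjGenLinGroup.mk g ^ 2 = 1 ↔ (g : M₂).trace = 0 := by
  have hCH := GL2.cayley_hamilton_two (g : M₂)
  rw [← map_pow, Matrix.ProjGenLinGroup.mk_eq_one,
    Matrix.GeneralLinearGroup.mem_center_iff_val_mem_range_scalar, Units.val_pow_eq_pow_val, pow_two,
    hCH]
  constructor
  · rintro ⟨r, hr⟩
    rw [Matrix.scalar_apply, ← Matrix.smul_one_eq_diagonal] at hr
    by_contra htr
    apply hg
    rw [Matrix.ProjGenLinGroup.mk_eq_one, Matrix.GeneralLinearGroup.mem_center_iff_val_mem_range_scalar]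
    refine ⟨(g : M₂).trace⁻¹ * (r + (g : M₂).det), ?_⟩
    rw [Matrix.scalar_apply, ← Matrix.smul_one_eq_diagonal, ← smul_smul, add_smul, hr, sub_add_cancel,
      smul_smul, inv_mul_cancel₀ htr, one_smul]
  · intro htr
    refine ⟨-(g : M₂).det, ?_⟩
    rw [htr, zero_smul, zero_sub, Matrix.scalar_apply, ← Matrix.smul_one_eq_diagonal, neg_smul]

/-! ### Elements fixing or swapping `0` and `∞` -/

/-- `τ_β δ_a` moves `0` to `β`. [folklore] -/
theorem transl_mul_homoth_smul_zero (β : k) (a : kˣ) :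
    (transl β * homoth a) • ((0 : k) : OnePoint k) = ((β : k) : OnePoint k) := by
  rw [transl_mul_homoth_smul_coe, mul_zero, zero_add]

/-- **An element fixing `∞` and `0` is a homothety** (Faber 2011, §4.1/§4.3: "we may assume that
`s` fixes `0` and `∞`. Hence `s = (α 0; 0 1)`"). [cite: Faber2011, §4.3] -/
theorem exists_eq_homoth_of_smul_infty_of_smul_zero {h : PGL(Fin 2, k)} (hi : h • (∞ : OnePoint k) = ∞)
    (h0 : h • ((0 : k) : OnePoint k) = ((0 : k) : OnePoint k)) :
    ∃ a : kˣ, (a : k) = derivInfty h ∧ h = homoth a := by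
  obtain ⟨β, a, ha, rfl⟩ := exists_eq_transl_mul_homoth hi
  rw [transl_mul_homoth_smul_zero, OnePoint.coe_eq_coe] at h0
  refine ⟨a, ha, ?_⟩
  rw [h0, AddChar.map_zero_eq_one, one_mul]

/-- The homothety `δ_a`, `a ≠ 1`, fixes exactly `∞` and `0`. [folklore] -/
theorem homoth_smul_eq_self_iff {a : kˣ} (ha : a ≠ 1) (z : OnePoint k) :
    homoth a • z = z ↔ z = ∞ ∨ z = ((0 : k) : OnePoint k) := by
  rw [homoth_apply, mk_smul]
  refine smul_eq_self_iff_of_eq_diagonal (d := ![(a : k), 1]) ?_ ?_ z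
  · ext i j
    fin_cases i <;> fin_cases j <;> simp
  · simpa using fun h => ha (Units.ext h)

omit [DecidableEq k] in
/-- The **antidiagonal involution** `w_b = [0 b; 1 0]` (`z ↦ b/z`), swapping `0` and `∞`. [folklore] -/
def antidiag (b : kˣ) : PGL(Fin 2, k) :=
  Matrix.ProjGenLinGroup.mk (Matrix.GeneralLinearGroup.mkOfDetNeZero !![(0 : k), b; 1, 0]
    (by simp [Matrix.det_fin_two_of]))

/-- `w_b` moves `∞` to `0`. [folklore] -/
@[simp] theorem antidiag_smul_infty (b : kˣ) : antidiag b • (∞ : OnePoint k) = ((0 : k) : OnePoint k) := by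
  rw [antidiag, mk_smul, OnePoint.smul_infty_eq_ite]
  simp [Matrix.GeneralLinearGroup.mkOfDetNeZero]

/-- `w_b` moves `0` to `∞`. [folklore] -/
@[simp] theorem antidiag_smul_zero (b : kˣ) : antidiag b • ((0 : k) : OnePoint k) = ∞ := by
  rw [antidiag, mk_smul, OnePoint.smul_some_eq_ite]
  simp [Matrix.GeneralLinearGroup.mkOfDetNeZero]

/-- `w_b` moves `z ≠ 0` to `b / z`. [folklore] -/
theorem antidiag_smul_coe (b : kˣ) {z : k} (hz : z ≠ 0) :
    antidiag b • ((z : k) : OnePoint k) = ((b / z : k) : OnePoint k) := by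
  rw [antidiag, mk_smul, OnePoint.smul_some_eq_ite]
  simp [Matrix.GeneralLinearGroup.mkOfDetNeZero, hz]

omit [DecidableEq k] in
/-- `w_b² = 1`. [folklore] -/
theorem antidiag_mul_self (b : kˣ) : antidiag b * antidiag b = 1 := by
  rw [antidiag, ← map_mul, Matrix.ProjGenLinGroup.mk_eq_one, GL2.mem_center_iff]
  simp [Matrix.GeneralLinearGroup.mkOfDetNeZero, Matrix.mul_apply, Fin.sum_univ_two]

omit [DecidableEq k] in
/-- `w_b⁻¹ = w_b`. [folklore] -/
theorem antidiag_inv (b : kˣ) : (antidiag b)⁻¹ = antidiag b :=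
  inv_eq_of_mul_eq_one_right (antidiag_mul_self b)

omit [DecidableEq k] in
/-- **`w_b` inverts homotheties**: `w_b δ_a w_b⁻¹ = δ_{a⁻¹}` (Faber 2011, §4.3:
`t (λ 0; 0 1) t⁻¹ = (λ⁻¹ 0; 0 1)`). [cite: Faber2011, §4.3] -/
theorem antidiag_mul_homoth_mul_antidiag (b a : kˣ) :
    antidiag b * homoth a * antidiag b = homoth a⁻¹ := by
  rw [antidiag, homoth_apply, homoth_apply, ← map_mul, ← map_mul, GL2.mk_eq_mk_iff_smul]
  refine ⟨(b * a)⁻¹, ?_⟩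
  rw [Units.val_mul, Units.val_mul, diagGL_val, diagGL_val, Units.val_inv_eq_inv_val,
    Units.val_inv_eq_inv_val, Units.val_mul]
  ext i j
  fin_cases i <;> fin_cases j <;> simp [Matrix.GeneralLinearGroup.mkOfDetNeZero]
  · field_simp

/-- **An element swapping `∞` and `0` is an antidiagonal involution** `w_b` (Faber 2011, §4.3: "Any
element of `G` that stabilizes `{0, ∞}` without fixing it pointwise must be of the form
`t = (0 τ; 1 0)`"). [cite: Faber2011, §4.3] -/
theorem exists_eq_antidiag_of_smul_infty_of_smul_zero {h : PGL(Fin 2, k)}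
    (hi : h • (∞ : OnePoint k) = ((0 : k) : OnePoint k)) (h0 : h • ((0 : k) : OnePoint k) = ∞) :
    ∃ b : kˣ, h = antidiag b := by
  -- `w_1 h` fixes `∞` and `0`
  have h1 : (antidiag 1 * h) • (∞ : OnePoint k) = ∞ := by rw [mul_smul, hi, antidiag_smul_zero]
  have h2 : (antidiag 1 * h) • ((0 : k) : OnePoint k) = ((0 : k) : OnePoint k) := by
    rw [mul_smul, h0, antidiag_smul_infty]
  obtain ⟨a, -, ha⟩ := exists_eq_homoth_of_smul_infty_of_smul_zero h1 h2
  refine ⟨a⁻¹, ?_⟩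
  have : h = antidiag 1 * homoth a := by
    rw [← ha, ← mul_assoc, antidiag_mul_self, one_mul]
  rw [this]
  -- `w_1 δ_a = w_{a⁻¹}`: compare on matrices
  rw [antidiag, antidiag, homoth_apply, ← map_mul, GL2.mk_eq_mk_iff_smul]
  refine ⟨a⁻¹, ?_⟩
  ext i j
  fin_cases i <;> fin_cases j <;> simp [Matrix.GeneralLinearGroup.mkOfDetNeZero]

/-- **An element commuting with a non-trivial homothety stabilises `{0, ∞}`** (the fixed points of
`δ_a`; Faber 2011, §4.3, proof of Prop. 4.7: "`s.x` and `s.y` are fixed points of `h'`. This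
means `s` stabilizes the pair `{x, y}`"). [cite: Faber2011, Prop. 4.7] -/
theorem smul_infty_mem_of_commute_homoth {a : kˣ} (ha : a ≠ 1) {g : PGL(Fin 2, k)}
    (hg : g * homoth a = homoth a * g) (z : OnePoint k) (hz : z = ∞ ∨ z = ((0 : k) : OnePoint k)) :
    g • z = ∞ ∨ g • z = ((0 : k) : OnePoint k) := by
  have hfix : homoth a • z = z := (homoth_smul_eq_self_iff ha z).mpr hz
  have : homoth a • (g • z) = g • z := by rw [← mul_smul, ← hg, mul_smul, hfix]
  exact (homoth_smul_eq_self_iff ha _).mp this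

/-- For a finite `H`: **two elements of `H` swapping `0` and `∞` differ by a homothety of `H`**
(`[Stab_H{0,∞} : Stab_H(0) ∩ Stab_H(∞)] ≤ 2`; Faber 2011, Prop. 4.6/4.7: "`N_G(H) = H` or `N_G(H)`
is dihedral with maximal cyclic subgroup `H` (of index `2`)"). [cite: Faber2011, Prop. 4.7] -/
theorem exists_eq_homoth_of_swap_of_swap {w w' : PGL(Fin 2, k)}
    (hw : w • (∞ : OnePoint k) = ((0 : k) : OnePoint k)) (hw0 : w • ((0 : k) : OnePoint k) = ∞)
    (hw' : w' • (∞ : OnePoint k) = ((0 : k) : OnePoint k)) (hw0' : w' • ((0 : k) : OnePoint k) = ∞) :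
    ∃ a : kˣ, w' = w * homoth a := by
  have h1 : (w⁻¹ * w') • (∞ : OnePoint k) = ∞ := by rw [mul_smul, hw', inv_smul_eq_iff, hw]
  have h2 : (w⁻¹ * w') • ((0 : k) : OnePoint k) = ((0 : k) : OnePoint k) := by
    rw [mul_smul, hw0', inv_smul_eq_iff, hw0]
  obtain ⟨a, -, ha⟩ := exists_eq_homoth_of_smul_infty_of_smul_zero h1 h2
  exact ⟨a, by rw [← ha, mul_inv_cancel_left]⟩

end Borel

end Literature.GroupTheory.SpecificGroups.PGL2
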